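import Literature.NumberTheory.EllipticCurves.TwoAdicImageNonSurjectiveFamiliesProofs
import Literature.NumberTheory.EllipticCurves.ManinConstantQuadraticTwistAtTwoOrdinaryProofs
import Literature.NumberTheory.EllipticCurves.NoConductorOne
import Literature.NumberTheory.EllipticCurves.Rank1Residual.Predicates
import HarnessLib

/-!
# The `2`-adic image of a curve GOOD ORDINARY at `2` is decided modulo `4`: two of
# Dokchitser–Dokchitser's exceptional families never meet good ordinary reduction at `2` (proofs only)

Topic `NumberTheory/EllipticCurves`; theorem-only `Proofs`-style file (no definition, no named fact,
no instance, no `sorry`; D-0014/D-0026), continuing `TwoAdicImageNonSurjectiveFamiliesProofs`.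

For an elliptic curve `E/ℚ` in its globally minimal equation `W` with GOOD reduction at `2`, the
minimal discriminant `Δ` is odd, so `±2Δ` is never a rational square (odd `2`-adic valuation): by
Dokchitser–Dokchitser (3) **`ρ̄_{E,8}` is onto as soon as `ρ̄_{E,4}` is**, and with the mod-`8` lift the
whole `2`-adic image is decided modulo `4` (`forall_hasSurjectiveModNGaloisRep_two_pow_iff_four_of_good_two`).
If moreover the reduction is ORDINARY (`a₂(E)` odd ⟺ `a₁` odd ⟹ `c₄` odd) then `j(E) = c₄³/Δ` is a
`2`-adic UNIT, whereas `-4t³(t + 8)` has `2`-adic valuation `≡ 2 (mod 4)` or `≥ 14` for every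
`t ∈ ℚ ∖ {0, -8}` — so `j(E) ≠ -4t³(t + 8)`: **the Dokchitser–Dokchitser curve (image conjugate into
`ℍ ≤ GL₂(ℤ/4ℤ)`) never meets good ordinary reduction at `2`** (`j_ne_of_goodOrd_two`).  Consequently, for
`E` good ordinary at `2` (`Rank1Residual.GoodOrd W 2`):

* `forall_hasSurjectiveModNGaloisRep_two_pow_iff_of_goodOrd_two` — `ρ_{E,2^∞}` is onto iff `E(ℚ)[2] = 0`,
  `Δ ∉ ℚ^{×2}` and `-Δ ∉ ℚ^{×2}`;
* `offHabitat_cases_of_goodOrd_two` — off the surjective-`2`-adic-image habitat there are exactly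
  THREE strata: (β) a rational point of order `2`; (γ₁) none, and `Δ ∈ ℚ^{×2}` (`C₃` image modulo `2`);
  (γ₂) `ρ̄₂` onto and `-Δ ∈ ℚ^{×2}` (`ℚ(√Δ) = ℚ(i)`, image of index `2` in `GL₂(ℤ/4ℤ)`).  The families
  (γ₃) `j = -4t³(t + 8)` and (γ₄) `±2Δ ∈ ℚ^{×2}` of the general classification are EMPTY here.

Written for the BSD cell `bsd-2adic` (item 19218 `GoodOrdinaryRankZeroTwoConverse`: the off-habitat
complement of the rank-`0` `2`-converse at a good ordinary `2` has three pieces, not five).  Nothing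
about BSD is claimed.

## References

* [DokchitserDokchitserMathZ2012] T. Dokchitser, V. Dokchitser, *Surjectivity of mod `2ⁿ`
  representations of elliptic curves*, Math. Z. 272 (2012) 961–964, Theorem (1)–(3) and Lemma.
* [SilvermanAEC2009] J. H. Silverman, *The Arithmetic of Elliptic Curves*, 2nd ed., GTM 106 (2009),
  III.1, V.4 (ordinary ⟺ `ā₁ ≠ 0` in characteristic `2`), VII.5 Prop. 5.1, Exercise 8.15.
* [RouseZureickbrown2015] J. Rouse, D. Zureick-Brown, *Elliptic curves over `ℚ` and `2`-adic images
  of Galois*, Res. Number Theory 1 (2015), §1.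
-/

set_option autoImplicit false

open WeierstrassCurve

namespace Literature.NumberTheory.EllipticCurves

open Rank1Residual

/-! ### §1. Two `2`-adic valuation computations -/

/-- **`2Δ` is not a rational square for `Δ` an odd integer** (its `2`-adic valuation is `1`).
[cite: DokchitserDokchitserMathZ2012, Theorem (3) (the condition Δ ∉ ±2·ℚ^{×2})] -/
theorem not_isSquare_two_mul_intCast_of_odd {D : ℤ} (hD : Odd D) : ¬ IsSquare (2 * (D : ℚ)) := by
  rintro ⟨s, hs⟩
  have hD0 : (D : ℚ) ≠ 0 := by
    exact_mod_cast fun h ↦ (Int.not_even_iff_odd.mpr hD) (by simp [h])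
  have h2D : (2 * (D : ℚ)) ≠ 0 := mul_ne_zero two_ne_zero hD0
  have hs0 : s ≠ 0 := fun h ↦ h2D (by rw [hs, h, mul_zero])
  have hv : padicValRat 2 (2 * (D : ℚ)) = 1 := by
    rw [padicValRat.mul two_ne_zero hD0, show (2 : ℚ) = ((2 : ℕ) : ℚ) by norm_num,
      padicValRat.self one_lt_two, padicValRat.of_int,
      padicValInt.eq_zero_of_not_dvd (by simpa [even_iff_two_dvd] using Int.not_even_iff_odd.mpr hD)]
    norm_num
  have hv' : padicValRat 2 (s * s) = padicValRat 2 s + padicValRat 2 s := padicValRat.mul hs0 hs0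
  rw [← hs, hv] at hv'
  omega

/-- **`-2Δ` is not a rational square for `Δ` an odd integer.** [cite: DokchitserDokchitserMathZ2012, Theorem (3)] -/
theorem not_isSquare_neg_two_mul_intCast_of_odd {D : ℤ} (hD : Odd D) : ¬ IsSquare (-2 * (D : ℚ)) := by
  have h := not_isSquare_two_mul_intCast_of_odd (D := -D) hD.neg
  intro hsq
  apply h
  simpa [mul_neg, neg_mul] using hsq

/-- **A `2`-adic unit is never `-4t³(t + 8)`**: for odd integers `c`, `D` and every `t ∈ ℚ`,
`c³/D ≠ -4t³(t + 8)`.  (For `t ∉ {0, -8}` the `2`-adic valuation of the right-hand side is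
`2 + 3v(t) + v(t + 8)`, which is `2 + 4v(t) ≡ 2 (mod 4)` if `v(t) < 3`, `5 + 3v(t) ≥ 17` if
`v(t) > 3`, and `≥ 14` if `v(t) = 3`; never `0`.)
[cite: DokchitserDokchitserMathZ2012, Lemma (3) (the family j = -4t³(t+8))] -/
theorem intCast_pow_div_ne_of_odd {c D : ℤ} (hc : Odd c) (hD : Odd D) (t : ℚ) :
    (c : ℚ) ^ 3 / D ≠ -4 * t ^ 3 * (t + 8) := by
  haveI : Fact (Nat.Prime 2) := ⟨Nat.prime_two⟩
  have hc0 : (c : ℚ) ≠ 0 := by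
    exact_mod_cast fun h ↦ (Int.not_even_iff_odd.mpr hc) (by simp [h])
  have hD0 : (D : ℚ) ≠ 0 := by
    exact_mod_cast fun h ↦ (Int.not_even_iff_odd.mpr hD) (by simp [h])
  have hvc : padicValRat 2 (c : ℚ) = 0 := by
    rw [padicValRat.of_int, padicValInt.eq_zero_of_not_dvd
      (by simpa [even_iff_two_dvd] using Int.not_even_iff_odd.mpr hc)]
    simp
  have hvD : padicValRat 2 (D : ℚ) = 0 := by
    rw [padicValRat.of_int, padicValInt.eq_zero_of_not_dvd
      (by simpa [even_iff_two_dvd] using Int.not_even_iff_odd.mpr hD)]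
    simp
  have hlhs : padicValRat 2 ((c : ℚ) ^ 3 / D) = 0 := by
    rw [padicValRat.div (pow_ne_zero 3 hc0) hD0, padicValRat.pow, hvc, hvD]; norm_num
  intro h
  -- `t ≠ 0` and `t + 8 ≠ 0`, since the left-hand side is non-zero
  have hlhs0 : (c : ℚ) ^ 3 / D ≠ 0 := div_ne_zero (pow_ne_zero 3 hc0) hD0
  have ht0 : t ≠ 0 := by
    rintro rfl; rw [h] at hlhs0; exact hlhs0 (by ring)
  have ht8 : t + 8 ≠ 0 := by
    intro h8; rw [h, h8] at hlhs0; exact hlhs0 (by ring)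
  -- valuation of the right-hand side
  have h4 : padicValRat 2 (-4 : ℚ) = 2 := by
    rw [show (-4 : ℚ) = -(((2 : ℕ) : ℚ) ^ 2) by norm_num, padicValRat.neg, padicValRat.pow,
      padicValRat.self one_lt_two]
    norm_num
  have h8v : padicValRat 2 (8 : ℚ) = 3 := by
    rw [show (8 : ℚ) = ((2 : ℕ) : ℚ) ^ 3 by norm_num, padicValRat.pow, padicValRat.self one_lt_two]
    norm_num
  have hrhs : padicValRat 2 (-4 * t ^ 3 * (t + 8)) =
      2 + 3 * padicValRat 2 t + padicValRat 2 (t + 8) := by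
    rw [padicValRat.mul (mul_ne_zero (by norm_num) (pow_ne_zero 3 ht0)) ht8,
      padicValRat.mul (by norm_num) (pow_ne_zero 3 ht0), padicValRat.pow, h4]
    push_cast
    ring
  have hkey : 2 + 3 * padicValRat 2 t + padicValRat 2 (t + 8) = 0 := by
    rw [← hrhs, ← h, hlhs]
  -- case analysis on `v(t)` against `v(8) = 3`
  rcases lt_trichotomy (padicValRat 2 t) 3 with hlt | heq | hgt
  · have hsum : padicValRat 2 (t + 8) = padicValRat 2 t :=
      padicValRat.add_eq_of_lt ht8 ht0 (by norm_num) (by rw [h8v]; exact hlt)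
    rw [hsum] at hkey
    omega
  · have hmin := padicValRat.min_le_padicValRat_add (p := 2) ht8
    rw [h8v, heq, min_self] at hmin
    omega
  · have hsum : padicValRat 2 (t + 8) = 3 := by
      rw [add_comm, padicValRat.add_eq_of_lt (by rwa [add_comm]) (by norm_num) ht0 (by rw [h8v]; exact hgt),
        h8v]
    rw [hsum] at hkey
    omega

/-! ### §2. Good (ordinary) reduction at `2`: `Δ` odd (and `c₄` odd, `j` a `2`-adic unit) -/

section GoodAtTwo

variable (W : WeierstrassCurve ℚ) [W.IsElliptic] [W.IsGloballyMinimal]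

/-- **`j = c₄³/Δ` read on the minimal equation**: `W.j = (c₄(M) : ℚ)³ / (Δ(M) : ℚ)` for the
integral model `M = integralModelInt W` (the Literature-side twin of the summit-side
`Summit.BirchSwinnertonDyer.Rank1Residual.EisensteinPrimes.j_eq_intModel`, which a Literature file
cannot import). [cite: SilvermanAEC2009, III.1 (j = c₄³/Δ) and VIII.8] -/
theorem j_eq_intCast_c₄_pow_div_intCast_Δ :
    W.j = ((integralModelInt W).c₄ : ℚ) ^ 3 / ((integralModelInt W).Δ : ℚ) := by
  have hc₄ : W.c₄ = ((integralModelInt W).c₄ : ℚ) := by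
    have h := (integralModelInt W).map_c₄ (Int.castRingHom ℚ)
    rw [map_integralModelInt, eq_intCast] at h
    exact h
  have hΔ : W.Δ = ((integralModelInt W).Δ : ℚ) := by
    have h := (integralModelInt W).map_Δ (Int.castRingHom ℚ)
    rw [map_integralModelInt, eq_intCast] at h
    exact h
  rw [WeierstrassCurve.j, Units.val_inv_eq_inv_val, WeierstrassCurve.coe_Δ', ← hc₄, ← hΔ,
    inv_mul_eq_div]

omit [W.IsElliptic] in
/-- **Good reduction at `2` ⟹ the minimal discriminant is odd** (Silverman VII.5.1(a): `v₂(Δ) = 0` on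
the minimal equation). [cite: SilvermanAEC2009, VII.5 Prop. 5.1(a)] -/
theorem odd_Δ_integralModelInt_of_good_two (hgood : W.HasGoodReductionAtPrime 2) :
    Odd (integralModelInt W).Δ := by
  have h := W.not_dvd_minimalDiscriminantInt_of_hasGoodReductionAtPrime' 2 hgood
  rw [minimalDiscriminantInt] at h
  rcases Int.even_or_odd (integralModelInt W).Δ with he | ho
  · exact absurd (even_iff_two_dvd.mp he) (by exact_mod_cast h)
  · exact ho

/-- **Good ORDINARY reduction at `2` ⟹ `c₄` and `Δ` of the minimal equation are odd**: ordinary at a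
good `2` means `a₂(E) = 3 - #Ẽ(𝔽₂)` odd, i.e. `a₁` odd (`ā₁` is the Hasse invariant in characteristic
`2`), hence `c₄ = b₂² - 24b₄` odd; and `Δ` odd by good reduction.
[cite: SilvermanAEC2009, V.4 and Exercise 5.7 (ordinary ⟺ ā₁ ≠ 0), Exercise 8.15(a), VII.5 Prop. 5.1(a)] -/
theorem odd_c₄_and_odd_Δ_of_goodOrd_two (h : GoodOrd W 2) :
    Odd (integralModelInt W).c₄ ∧ Odd (integralModelInt W).Δ := by
  obtain ⟨hgood, hap⟩ := h
  have hodd : Odd (W.frobeniusTrace 2) := by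
    rcases Int.even_or_odd (W.frobeniusTrace 2) with he | ho
    · exact absurd (even_iff_two_dvd.mp he) hap
    · exact ho
  exact ⟨(integralModelInt W).odd_c₄_int_of_odd_a₁
      (odd_a₁_of_hasGoodReductionAtPrime_two_of_odd_frobeniusTrace_two W hgood hodd),
    odd_Δ_integralModelInt_of_good_two W hgood⟩

/-- **At a good ORDINARY `2` the `j`-invariant never lies on the Dokchitser–Dokchitser curve
`j = -4t³(t + 8)`** (it is a `2`-adic unit). So family (γ₃) of the off-habitat classification is
EMPTY for curves good ordinary at `2`. [cite: DokchitserDokchitserMathZ2012, Theorem (2) and Lemma (3)] -/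
theorem j_ne_of_goodOrd_two (h : GoodOrd W 2) (t : ℚ) : W.j ≠ -4 * t ^ 3 * (t + 8) := by
  obtain ⟨hc₄, hΔ⟩ := odd_c₄_and_odd_Δ_of_goodOrd_two W h
  rw [j_eq_intCast_c₄_pow_div_intCast_Δ W]
  exact intCast_pow_div_ne_of_odd hc₄ hΔ t

omit [W.IsElliptic] in
/-- **At a good `2` neither `2Δ` nor `-2Δ` is a rational square** (`Δ` = the minimal discriminant is
odd). So family (γ₄) of the off-habitat classification is EMPTY for curves good at `2`.
[cite: DokchitserDokchitserMathZ2012, Theorem (3)] [cite: SilvermanAEC2009, VII.5 Prop. 5.1(a)] -/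
theorem not_isSquare_two_mul_Δ_of_good_two (hgood : W.HasGoodReductionAtPrime 2) :
    ¬ IsSquare (2 * W.Δ) ∧ ¬ IsSquare (-2 * W.Δ) := by
  have hΔ := odd_Δ_integralModelInt_of_good_two W hgood
  rw [← cast_minimalDiscriminantInt W, minimalDiscriminantInt]
  exact ⟨not_isSquare_two_mul_intCast_of_odd hΔ, not_isSquare_neg_two_mul_intCast_of_odd hΔ⟩

/-- **At a good `2`, `ρ̄_{E,8}` is onto iff `ρ̄_{E,4}` is onto** (Dokchitser–Dokchitser (3) with `Δ`
odd). [cite: DokchitserDokchitserMathZ2012, Theorem (3)] -/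
theorem hasSurjectiveModNGaloisRep_eight_iff_four_of_good_two (hgood : W.HasGoodReductionAtPrime 2) :
    W.HasSurjectiveModNGaloisRep 8 ↔ W.HasSurjectiveModNGaloisRep 4 := by
  rw [DokchitserDokchitser2012.hasSurjectiveModNGaloisRep_eight_iff]
  obtain ⟨h₁, h₂⟩ := not_isSquare_two_mul_Δ_of_good_two W hgood
  exact ⟨fun h ↦ h.1, fun h ↦ ⟨h, h₁, h₂⟩⟩

/-- **At a good `2` the `2`-adic image is decided modulo `4`**: `ρ̄_{E,2^m}` onto for every `m` iff
`ρ̄_{E,4}` onto. [cite: DokchitserDokchitserMathZ2012, Theorem (3) and Introduction] [cite: RouseZureickbrown2015, §1] -/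
theorem forall_hasSurjectiveModNGaloisRep_two_pow_iff_four_of_good_two
    (hgood : W.HasGoodReductionAtPrime 2) :
    (∀ m : ℕ, W.HasSurjectiveModNGaloisRep ((2 ^ m : ℕ) : ℤ)) ↔ W.HasSurjectiveModNGaloisRep 4 := by
  rw [forall_hasSurjectiveModNGaloisRep_two_pow_iff_eight,
    hasSurjectiveModNGaloisRep_eight_iff_four_of_good_two W hgood]

/-- **At a good ORDINARY `2`, `ρ̄_{E,4}` is onto iff `ρ̄_{E,2}` is onto and `-Δ ∉ ℚ^{×2}`**
(Dokchitser–Dokchitser (2) with the `j`-clause automatic). [cite: DokchitserDokchitserMathZ2012, Theorem (2)] -/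
theorem hasSurjectiveModNGaloisRep_four_iff_of_goodOrd_two (h : GoodOrd W 2) :
    W.HasSurjectiveModNGaloisRep 4 ↔ W.HasSurjectiveModNGaloisRep 2 ∧ ¬ IsSquare (-W.Δ) := by
  rw [DokchitserDokchitser2012.hasSurjectiveModNGaloisRep_four_iff]
  exact ⟨fun h' ↦ ⟨h'.1, h'.2.1⟩, fun h' ↦ ⟨h'.1, h'.2, j_ne_of_goodOrd_two W h⟩⟩

/-- **The habitat criterion at a good ORDINARY `2`**: `ρ̄_{E,2^m}` is onto for every `m` iff `E(ℚ)`
has no point of order `2`, `Δ ∉ ℚ^{×2}` and `-Δ ∉ ℚ^{×2}` — three conditions instead of six.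
[cite: DokchitserDokchitserMathZ2012, Theorem (1)–(3)] [cite: RouseZureickbrown2015, §1] -/
theorem forall_hasSurjectiveModNGaloisRep_two_pow_iff_of_goodOrd_two (h : GoodOrd W 2) :
    (∀ m : ℕ, W.HasSurjectiveModNGaloisRep ((2 ^ m : ℕ) : ℤ)) ↔
      (∀ P : W.toAffine.Point, 2 • P = 0 → P = 0) ∧ ¬ IsSquare W.Δ ∧ ¬ IsSquare (-W.Δ) := by
  rw [forall_hasSurjectiveModNGaloisRep_two_pow_iff_four_of_good_two W h.1,
    hasSurjectiveModNGaloisRep_four_iff_of_goodOrd_two W h, hasSurjectiveModNGaloisRep_two_iff]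
  exact and_assoc

/-- **Off the habitat at a good ORDINARY `2`: exactly three strata.**  If `ρ_{E,2^∞}` is not onto
then (β) `E(ℚ)` has a point of order `2` (`E[2]` reducible), or (γ₁) it has none and `Δ ∈ ℚ^{×2}`
(`C₃` image modulo `2`), or (γ₂) `ρ̄₂` is onto and `-Δ ∈ ℚ^{×2}`.  The general families (γ₃)
`j = -4t³(t + 8)` and (γ₄) `±2Δ ∈ ℚ^{×2}` do not occur (`j_ne_of_goodOrd_two`,
`not_isSquare_two_mul_Δ_of_good_two`). [cite: DokchitserDokchitserMathZ2012, Theorem (1)–(3)] -/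
theorem offHabitat_cases_of_goodOrd_two (h : GoodOrd W 2)
    (hoff : ¬ ∀ m : ℕ, W.HasSurjectiveModNGaloisRep ((2 ^ m : ℕ) : ℤ)) :
    (∃ P : W.toAffine.Point, P ≠ 0 ∧ 2 • P = 0) ∨
      ((∀ P : W.toAffine.Point, 2 • P = 0 → P = 0) ∧ IsSquare W.Δ) ∨
      (W.HasSurjectiveModNGaloisRep 2 ∧ IsSquare (-W.Δ)) := by
  rw [forall_hasSurjectiveModNGaloisRep_two_pow_iff_of_goodOrd_two W h] at hoff
  by_cases hP : ∀ P : W.toAffine.Point, 2 • P = 0 → P = 0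
  · by_cases hΔ : IsSquare W.Δ
    · exact Or.inr (Or.inl ⟨hP, hΔ⟩)
    · have hs2 : W.HasSurjectiveModNGaloisRep 2 := (hasSurjectiveModNGaloisRep_two_iff W).mpr ⟨hP, hΔ⟩
      by_cases hΔ' : IsSquare (-W.Δ)
      · exact Or.inr (Or.inr ⟨hs2, hΔ'⟩)
      · exact absurd ⟨hP, hΔ, hΔ'⟩ hoff
  · left
    by_contra hex
    apply hP
    intro P h2P
    by_contra hP0
    exact hex ⟨P, hP0, h2P⟩

/-- **Off-habitat eliminator at a good ORDINARY `2`** (three strata, the form consumed by glue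
theorems). [cite: DokchitserDokchitserMathZ2012, Theorem (1)–(3)] -/
theorem offHabitat_elim_of_goodOrd_two {C : Prop} (h : GoodOrd W 2)
    (hoff : ¬ ∀ m : ℕ, W.HasSurjectiveModNGaloisRep ((2 ^ m : ℕ) : ℤ))
    (hβ : (∃ P : W.toAffine.Point, P ≠ 0 ∧ 2 • P = 0) → C)
    (hγ₁ : (∀ P : W.toAffine.Point, 2 • P = 0 → P = 0) → IsSquare W.Δ → C)
    (hγ₂ : W.HasSurjectiveModNGaloisRep 2 → IsSquare (-W.Δ) → C) : C := by
  rcases offHabitat_cases_of_goodOrd_two W h hoff with hb | ⟨h1, h2⟩ | ⟨h1, h2⟩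
  · exact hβ hb
  · exact hγ₁ h1 h2
  · exact hγ₂ h1 h2

end GoodAtTwo

end Literature.NumberTheory.EllipticCurves
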